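import Literature.NumberTheory.Automorphic.CuspidalContragredientProofs
import Literature.NumberTheory.Automorphic.AutomorphicTwistBJ
import Literature.NumberTheory.GaloisRepresentations.FramedRepDualProofs
import HarnessLib

/-!
# The transpose-inverse twist `π^τ` (`φ ↦ φ ∘ τ`, `τ(g) = w ᵗg⁻¹ w`) of an automorphic
# representation of `GL_n(𝔸_K)` — the contragredient datum (Gelfand–Kazhdan; Jacquet–Langlands)

Topic `Literature/NumberTheory/Automorphic`.  DEFINITIONS `AutomorphicRepData.transposeInv`,
`CuspidalAutomorphicRepData.transposeInv`: the Borel–Jacquet datum `π^τ = (W ∘ τ, W' ∘ τ)` obtained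
from `π = (W, W')` by the outer automorphism `τ(g) = w₀ ᵗg⁻¹ w₀` of `GL_n(𝔸_K)` — exactly the datum
constructed inline in the discharge `CuspidalAutomorphicRepData.exists_contragredient_satake_holds`
(`CuspidalContragredientProofs`), now NAMED so that the dual side `L(s, π^∨)` of the functional
equation of the standard `L`-function of cuspidal `GL(2)` (`JacquetLanglands1970_standardLTheoryGL2`,
clause (an), and its dual clauses (U∨), (R∨), (N∨)) can be stated: by Gelfand–Kazhdan the local
components of `π^τ` are the contragredients `π_v^∨` (Bernstein–Zelevinsky 1976, Thm. 7.3; for the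
unramified places this is the Satake statement below), so `π^τ ≅ π^∨` (Jacquet–Langlands 1970,
proof of Thm. 11.1; Cogdell 2004, §1).  API:

* `HasSatakeParamAt.transposeInv` — Satake parameters invert: `t_{π^τ,v} = t_{π,v}⁻¹`
  (`hasSatakeParamAt_map_funLeft_weylLong_mul_glTransposeInv_mul_weylLong`; Getz–Hahn Prop. 7.6.2),
  hence `IsUnramifiedAt.transposeInv`;
* `transposeInv_transposeInv` — `τ` is an involution on data;
* `transposeInv_twist` — **`(π ⊗ ω)^τ = π^τ ⊗ ω⁻¹`** (`det τ(g) = (det g)⁻¹`,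
  `det_weylLong_mul_glTransposeInv_mul_weylLong`), the dictionary entry turning the dual clauses
  (R∨), (N∨) into the clauses (R), (N) for `π^τ` and `ω⁻¹`.

## References

* H. Jacquet, R. P. Langlands, *Automorphic Forms on GL(2)*, LNM 114 (1970), Thm. 11.1 (proof:
  `φ ↦ φ(ᵗg⁻¹)` realises `π̃`). [JacquetLanglands1970]
* J. W. Cogdell, *Lectures on L-functions, converse theorems, and functoriality for GLₙ*, Fields
  Inst. Monogr. 20 (2004), §1 (after Thm. 1.2), §2 Thm. 2.1. [CogdellAnalyticTheory2004]
* J. R. Getz, H. Hahn, *An Introduction to Automorphic Representations*, GTM 300 (2024),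
  Prop. 7.6.2. [GetzHahn2024]
-/

noncomputable section

open scoped MatrixGroups Matrix NNReal Classical
open NumberField IsDedekindDomain

namespace Literature.NumberTheory.Automorphic

open GaloisRepresentations (glTransposeInv coe_glTransposeInv_apply det_glTransposeInv HeckeCharacter)

variable {n : ℕ} {K : Type} [Field K] [NumberField K] {hcpt : isCompact_glFiniteIntegralLevel n K}

local notation "𝒟" => AutomorphyDatum.gl n K hcpt
local notation "τ𝔸[" g "]" => weylLong n (AdeleRing (𝓞 K) K) *
  glTransposeInv (Fin n) (AdeleRing (𝓞 K) K) g * weylLong n (AdeleRing (𝓞 K) K)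
set_option quotPrecheck false in
local notation "τ𝔸⋆" => LinearMap.funLeft ℂ ℂ (m := (AdelicGroupData.gl n K).Adelic)
  (n := (AdelicGroupData.gl n K).Adelic) fun g => τ𝔸[g]

/-! ### The definitions -/

/-- **The transpose-inverse twist `π^τ`** of an automorphic representation `π = (W, W')` of
`GL_n(𝔸_K)` (Borel–Jacquet datum): `(W ∘ τ, W' ∘ τ)` with `τ(g) = w₀ ᵗg⁻¹ w₀`; a realisation of the
contragredient `π^∨` (Jacquet–Langlands 1970, proof of Thm. 11.1; Cogdell 2004, §1).
[cite: JacquetLanglands1970, Thm. 11.1 (proof)] [cite: CogdellAnalyticTheory2004, §1] -/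
def AutomorphicRepData.transposeInv (π : AutomorphicRepData (𝒟)) : AutomorphicRepData (𝒟) where
  W := π.W.map τ𝔸⋆
  W' := π.W'.map τ𝔸⋆
  lt := map_funLeft_weylLong_mul_glTransposeInv_mul_weylLong_lt π.lt
  stable := π.stable.map_funLeft_weylLong_mul_glTransposeInv_mul_weylLong
  stable' := π.stable'.map_funLeft_weylLong_mul_glTransposeInv_mul_weylLong
  irreducible := irreducible_map_funLeft_weylLong_mul_glTransposeInv_mul_weylLong π.irreducible

/-- `(π^τ).W = W ∘ τ` (definitional). [folklore] -/
@[simp]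
theorem AutomorphicRepData.transposeInv_W (π : AutomorphicRepData (𝒟)) :
    π.transposeInv.W = π.W.map τ𝔸⋆ := rfl

/-- `(π^τ).W' = W' ∘ τ` (definitional). [folklore] -/
@[simp]
theorem AutomorphicRepData.transposeInv_W' (π : AutomorphicRepData (𝒟)) :
    π.transposeInv.W' = π.W'.map τ𝔸⋆ := rfl

/-- **The transpose-inverse twist of a CUSPIDAL automorphic representation is cuspidal**
(`φ ∘ τ` is a cusp form when `φ` is: `map_funLeft_weylLong_mul_glTransposeInv_mul_weylLong_cuspFormsGL_le`).
[cite: JacquetLanglands1970, Thm. 11.1 (proof)] [cite: CogdellAnalyticTheory2004, §1] -/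
def CuspidalAutomorphicRepData.transposeInv (π : CuspidalAutomorphicRepData n K hcpt) :
    CuspidalAutomorphicRepData n K hcpt :=
  ⟨π.1.transposeInv,
    (Submodule.map_mono π.2).trans map_funLeft_weylLong_mul_glTransposeInv_mul_weylLong_cuspFormsGL_le⟩

/-- The underlying automorphic representation of the cuspidal `π^τ` (definitional). [folklore] -/
@[simp]
theorem CuspidalAutomorphicRepData.transposeInv_val (π : CuspidalAutomorphicRepData n K hcpt) :
    π.transposeInv.1 = π.1.transposeInv := rfl

/-! ### API -/

/-- Two Borel–Jacquet data with the same `W` and `W'` are equal. [folklore] -/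
theorem AutomorphicRepData.ext_W {π₁ π₂ : AutomorphicRepData (𝒟)} (hW : π₁.W = π₂.W)
    (hW' : π₁.W' = π₂.W') : π₁ = π₂ := by
  cases π₁; cases π₂; cases hW; cases hW'; rfl

/-- **`τ` is an involution on data**: `(π^τ)^τ = π`. [folklore] -/
theorem AutomorphicRepData.transposeInv_transposeInv (π : AutomorphicRepData (𝒟)) :
    π.transposeInv.transposeInv = π :=
  AutomorphicRepData.ext_W
    (map_funLeft_map_funLeft_weylLong_mul_glTransposeInv_mul_weylLong π.W)
    (map_funLeft_map_funLeft_weylLong_mul_glTransposeInv_mul_weylLong π.W')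

/-- `(π^τ)^τ = π` for cuspidal data. [folklore] -/
theorem CuspidalAutomorphicRepData.transposeInv_transposeInv (π : CuspidalAutomorphicRepData n K hcpt) :
    π.transposeInv.transposeInv = π :=
  Subtype.ext π.1.transposeInv_transposeInv

/-- **Satake parameters of `π^τ` are the inverses**: `t_{π^τ, v} = t_{π, v}⁻¹` (Getz–Hahn 2024,
Prop. 7.6.2; `hasSatakeParamAt_map_funLeft_weylLong_mul_glTransposeInv_mul_weylLong`).
[cite: CogdellAnalyticTheory2004, §2 Thm. 2.1] -/
theorem AutomorphicRepData.HasSatakeParamAt.transposeInv {π : AutomorphicRepData (𝒟)}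
    {v : HeightOneSpectrum (𝓞 K)} {α : Multiset ℂ} (h : π.HasSatakeParamAt v α) :
    π.transposeInv.HasSatakeParamAt v (α.map (·⁻¹)) :=
  hasSatakeParamAt_map_funLeft_weylLong_mul_glTransposeInv_mul_weylLong π.stable' h

/-- `π^τ` is unramified wherever `π` is. [folklore] -/
theorem AutomorphicRepData.IsUnramifiedAt.transposeInv {π : AutomorphicRepData (𝒟)}
    {v : HeightOneSpectrum (𝓞 K)} (h : π.IsUnramifiedAt v) : π.transposeInv.IsUnramifiedAt v := by
  obtain ⟨α, hα⟩ := h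
  exact ⟨_, hα.transposeInv⟩

/-- `π` is unramified at `v` iff `π^τ` is. [folklore] -/
theorem AutomorphicRepData.isUnramifiedAt_transposeInv_iff (π : AutomorphicRepData (𝒟))
    (v : HeightOneSpectrum (𝓞 K)) : π.transposeInv.IsUnramifiedAt v ↔ π.IsUnramifiedAt v :=
  ⟨fun h => by simpa only [AutomorphicRepData.transposeInv_transposeInv] using h.transposeInv,
    fun h => h.transposeInv⟩

/-! ### `(π ⊗ ω)^τ = π^τ ⊗ ω⁻¹` -/

/-- `det (w₀ ᵗg⁻¹ w₀) = (det g)⁻¹`. [folklore] -/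
theorem det_weylLong_mul_glTransposeInv_mul_weylLong (g : GL (Fin n) (AdeleRing (𝓞 K) K)) :
    Matrix.GeneralLinearGroup.det τ𝔸[g] = (Matrix.GeneralLinearGroup.det g)⁻¹ := by
  rw [map_mul, map_mul, det_glTransposeInv, mul_comm (Matrix.GeneralLinearGroup.det _) _,
    mul_assoc, ← map_mul, weylLong_mul_self, map_one, mul_one]

/-- `(ω ∘ det) ∘ τ = ω⁻¹ ∘ det`. [folklore] -/
theorem detTwist_weylLong_mul_glTransposeInv_mul_weylLong (ω : HeckeCharacter K)
    (g : GL (Fin n) (AdeleRing (𝓞 K) K)) :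
    detTwist n ω τ𝔸[g] = detTwist n ω⁻¹ g := by
  rw [detTwist_apply, detTwist_apply', det_weylLong_mul_glTransposeInv_mul_weylLong, map_inv,
    GaloisRepresentations.HeckeCharacter.inv_apply]

/-- `τ⋆ ∘ (multiplication by ω ∘ det) = (multiplication by ω⁻¹ ∘ det) ∘ τ⋆`. [folklore] -/
theorem funLeft_comp_mulChar_detTwist (ω : HeckeCharacter K) :
    (τ𝔸⋆) ∘ₗ mulChar (detTwist n ω) = mulChar (detTwist n ω⁻¹) ∘ₗ (τ𝔸⋆) := by
  refine LinearMap.ext fun φ => funext fun g => ?_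
  simp only [LinearMap.comp_apply, LinearMap.funLeft_apply, mulChar_apply]
  rw [detTwist_weylLong_mul_glTransposeInv_mul_weylLong]

/-- **`(π ⊗ ω)^τ = π^τ ⊗ ω⁻¹`** as Borel–Jacquet data. [cite: JacquetLanglands1970, Thm. 11.1 (proof)] -/
theorem AutomorphicRepData.transposeInv_twist (π : AutomorphicRepData (𝒟)) (ω : HeckeCharacter K)
    (hω : ω.IsFiniteOrder) :
    (π.twist ω hω).transposeInv = π.transposeInv.twist ω⁻¹ (IsOfFinOrder.inv hω) := by
  refine AutomorphicRepData.ext_W ?_ ?_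
  · change (π.W.map (mulChar (detTwist n ω))).map τ𝔸⋆ =
      (π.W.map τ𝔸⋆).map (mulChar (detTwist n ω⁻¹))
    rw [← Submodule.map_comp, ← Submodule.map_comp, funLeft_comp_mulChar_detTwist]
  · change (π.W'.map (mulChar (detTwist n ω))).map τ𝔸⋆ =
      (π.W'.map τ𝔸⋆).map (mulChar (detTwist n ω⁻¹))
    rw [← Submodule.map_comp, ← Submodule.map_comp, funLeft_comp_mulChar_detTwist]

/-- **`(π ⊗ ω)^τ = π^τ ⊗ ω⁻¹`** for cuspidal data. [cite: JacquetLanglands1970, Thm. 11.1 (proof)] -/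
theorem CuspidalAutomorphicRepData.transposeInv_twist (π : CuspidalAutomorphicRepData n K hcpt)
    (ω : HeckeCharacter K) (hω : ω.IsFiniteOrder) :
    (π.twist ω hω).transposeInv = π.transposeInv.twist ω⁻¹ (IsOfFinOrder.inv hω) :=
  Subtype.ext (π.1.transposeInv_twist ω hω)

end Literature.NumberTheory.Automorphic

end
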